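import Literature.AnabelianGeometry.SemiGraphs.PSCSeparatingCoveringsTwoComponentAffineEdges
import Literature.AnabelianGeometry.SemiGraphs.PSCThreeChainShape
import HarnessLib

/-!
# [CombGC] Prop. 1.2, proof p. 9: EDGE-LIKE separating coverings at the THREE-COMPONENT CHAIN (row F-2827 / edge conjunct of F-2829)

Mochizuki, *A combinatorial version of the Grothendieck conjecture*, Tohoku Math. J. **59** (2007)
[CombGC], PROOF of Proposition 1.2, p. 9 (separating finite étale coverings: "by gluing together
appropriate finite étale coverings of the anabelioids `G_v`, `G_e`") [cite: MochizukiCombGC2007, Prop 1.2 proof p.9].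
Typed LEVEL-WISE by abc-iut-w4-d081 as `PSCDatum.EdgeLikeSeparatingCoverings` (row P12-L01-E; FACT rows
F-2827, edge conjunct of F-2829 / F-2830; universal closures refuted, instance forms at genuine carriers are
the content).

PROOF-ONLY file (abc-iut-f-164 gen 4): the instance at the THREE-COMPONENT CHAIN data of gen 3
(`PSCThreeChainShape.lean`: TWO nodes `ν_A`, `ν_B` with `Π_{ν_A} = cl ι⟨ε_A⟩`, `Π_{ν_B} = cl ι⟨η⟩`,
`ε_A = (c_{s₂}⋯c_{r−1})∏_{i<g₀}[a_i,b_i]`, `η = (c_{s₁}⋯c_{r−1})∏_{i<g₁}[a_i,b_i]`, cusp groups the closed cusp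
inertia groups; `2 ≤ s₁`, `s₁ + 2 ≤ s₂`, `s₂ + 2 ≤ r`), by abc-iut-f-166's engine
`edgeLikeSeparatingCoverings_of_rankOneFreeFactors`: every edge generator is a member of a free basis of
`Γ_{g,r}` (both node loops are members of gen 3's chain basis; every `c_j` by `exists_freeGroupBasis_eq_c`),
and any two distinct edges are separated by a cusp character `δ_k − δ_m : Γ_{g,r} → ℤ/3`
(`exists_handleCuspCharacter`), whose values on `ε_A`, `η` are `[s₂ ≤ k] − [s₂ ≤ m]`, `[s₁ ≤ k] − [s₁ ≤ m]`.

* `edgeLikeSeparatingCoverings_of_threeChain` — `G.EdgeLikeSeparatingCoverings` (`V' := V`) at every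
  three-component chain datum: node/node, node/cusp, cusp/node and cusp/cusp pairs alike.

A shape instance is consistency evidence for the typed schema, not the printed statement for all pointed
stable curves (cell FOUNDATIONS rows 13–14).  0 definitions; nothing here takes a side on [IUTchIII] Cor. 3.12.
-/

noncomputable section

namespace Literature.AnabelianGeometry.SemiGraphs

namespace PSCDatum

open scoped Pointwise
open Literature.GroupTheory.CombinatorialGroupTheory
open Literature.GroupTheory.CombinatorialGroupTheory.PuncturedSurfaceGroup (a b c cuspInertia
  exists_chainBases exists_freeGroupBasis_eq_c exists_handleCuspCharacter)
open SemiGraphOfAnabelioids (IsProSigmaCompletion)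
open TwoComponentAffine (character_nodeLoop sum_ite_twoDelta sum_twoDelta)
open Multiplicative (ofAdd)

section ThreeChain

variable {P : Type} [Group P] [TopologicalSpace P] [IsTopologicalGroup P]
variable [CompactSpace P] [T2Space P] [TotallyDisconnectedSpace P] {Sigma : Set ℕ} {g r : ℕ}

/-- `ofAdd x ≠ 1` in `ℤ/3` for `x = 1`. [cite: MochizukiCombGC2007, Prop 1.2 proof p.9] -/
private theorem ofAdd_one_ne_one₃ : (ofAdd (1 : ZMod 3) : Multiplicative (ZMod 3)) ≠ 1 := by
  intro h
  have h1 : (1 : ZMod 3) = 0 := Multiplicative.ofAdd.injective (h.trans ofAdd_zero.symm)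
  exact absurd h1 (by decide)

/-- An index different from two given ones in `Fin r`, `r ≥ 3`. [cite: MochizukiCombGC2007, Prop 1.2 proof p.9] -/
private theorem exists_ne_ne₃ (hr : 3 ≤ r) (k₁ k₂ : Fin r) : ∃ m : Fin r, m ≠ k₁ ∧ m ≠ k₂ := by
  classical
  by_contra h
  push Not at h
  have hsub : (Finset.univ : Finset (Fin r)) ⊆ {k₁, k₂} := fun m _ => by
    rcases eq_or_ne m k₁ with h1 | h1
    · simp [h1]
    · simp [h m h1]
  have hcard := Finset.card_le_card hsub
  rw [Finset.card_univ, Fintype.card_fin] at hcard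
  have h2 : ({k₁, k₂} : Finset (Fin r)).card ≤ 2 := Finset.card_le_two
  omega

/-- An index in the window `[t, t+1]` different from a given one (`t + 2 ≤ r`).
[cite: MochizukiCombGC2007, Prop 1.2 proof p.9] -/
private theorem exists_window_ne (t : ℕ) (ht : t + 2 ≤ r) (k₂ : Fin r) :
    ∃ k : Fin r, t ≤ (k : ℕ) ∧ (k : ℕ) ≤ t + 1 ∧ k ≠ k₂ := by
  by_cases h : (k₂ : ℕ) = t
  · exact ⟨⟨t + 1, by omega⟩, by simp only; omega, le_rfl, fun hk => by
      have := congrArg Fin.val hk; simp only at this; omega⟩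
  · exact ⟨⟨t, by omega⟩, le_rfl, by simp only; omega, fun hk => by
      have := congrArg Fin.val hk; exact h this.symm⟩

/-- **The cusp characters `δ_k − δ_m` of `Γ_{g,r}` on the two node loops of the chain**: for `k`, `m` a
homomorphism `χ : Γ_{g,r} → ℤ/3` with `χ(c_j) = [j = k] − [j = m]`, `χ(ε_A) = [s₂ ≤ k] − [s₂ ≤ m]` and
`χ(η) = [s₁ ≤ k] − [s₁ ≤ m]`. [cite: MochizukiCombGC2007, Prop 1.2 proof p.9] -/
private theorem exists_twoDelta_character₂ (g₀ g₁ s₁ s₂ : ℕ) (k m : Fin r) (εA η : PuncturedSurfaceGroup g r)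
    (hεA : εA = ((List.finRange r).map fun j : Fin r =>
          if s₂ ≤ (j : ℕ) then PuncturedSurfaceGroup.c (g := g) j else 1).prod *
        ((List.finRange g).map fun i : Fin g => if (i : ℕ) < g₀ then
          PuncturedSurfaceGroup.a (r := r) i * PuncturedSurfaceGroup.b i *
            (PuncturedSurfaceGroup.a i)⁻¹ * (PuncturedSurfaceGroup.b i)⁻¹ else 1).prod)
    (hη : η = ((List.finRange r).map fun j : Fin r =>
          if s₁ ≤ (j : ℕ) then PuncturedSurfaceGroup.c (g := g) j else 1).prod *
        ((List.finRange g).map fun i : Fin g => if (i : ℕ) < g₁ then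
          PuncturedSurfaceGroup.a (r := r) i * PuncturedSurfaceGroup.b i *
            (PuncturedSurfaceGroup.a i)⁻¹ * (PuncturedSurfaceGroup.b i)⁻¹ else 1).prod) :
    ∃ χ : PuncturedSurfaceGroup g r →* Multiplicative (ZMod 3),
      (∀ j : Fin r, χ (c j) =
        ofAdd ((if j = k then (1 : ZMod 3) else 0) + (if j = m then (-1 : ZMod 3) else 0))) ∧
      χ εA = ofAdd ((if s₂ ≤ (k : ℕ) then (1 : ZMod 3) else 0) + (if s₂ ≤ (m : ℕ) then (-1 : ZMod 3) else 0)) ∧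
      χ η = ofAdd ((if s₁ ≤ (k : ℕ) then (1 : ZMod 3) else 0) + (if s₁ ≤ (m : ℕ) then (-1 : ZMod 3) else 0)) := by
  classical
  obtain ⟨χ, -, -, hc⟩ := exists_handleCuspCharacter (g := g) (r := r) (n := 3) (fun _ => 0) (fun _ => 0)
    (fun j => (if j = k then (1 : ZMod 3) else 0) + (if j = m then (-1 : ZMod 3) else 0))
    (sum_twoDelta k m)
  refine ⟨χ, hc, ?_, ?_⟩
  · rw [hεA, character_nodeLoop χ hc g₀ s₂, sum_ite_twoDelta]
  · rw [hη, character_nodeLoop χ hc g₁ s₁, sum_ite_twoDelta]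

/-- **Row F-2827 `EdgeLikeSeparatingCoverings` (edge conjunct of F-2829) at the genuine THREE-COMPONENT
CHAIN data** (two nodes `ν_A`, `ν_B`, cusps `≃ Fin r` with the closed cusp inertia groups; `Π` profinite in
`Type`): for every open normal `V` and any two DISTINCT level-`V` edges there is an open `U ≤ V` (`V' := V`),
normal in `V`, trivial over the second and nontrivial over the first — node/node, node/cusp, cusp/node and
cusp/cusp pairs alike. [cite: MochizukiCombGC2007, Prop 1.2 proof p.9] -/
theorem edgeLikeSeparatingCoverings_of_threeChain (hne : Sigma.Nonempty)
    (hprime : ∀ p ∈ Sigma, p.Prime) (ι : PuncturedSurfaceGroup g r →* P)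
    (hι : IsProSigmaCompletion Sigma ι) (G : PSCDatum P) {g₀ g₁ s₁ s₂ : ℕ} (hg : g₀ ≤ g₁) (hs₁ : 2 ≤ s₁)
    (hs₁₂ : s₁ + 2 ≤ s₂) (hs₂ : s₂ + 2 ≤ r) (e : G.graph.C ≃ Fin r)
    (hC : ∀ c', G.cuspGp c' = ((cuspInertia (g := g) (e c')).map ι).topologicalClosure)
    (v₀ vm v₁ : G.graph.V) (hV : ∀ w, w = v₀ ∨ w = vm ∨ w = v₁) (εA η : PuncturedSurfaceGroup g r)
    (hεA : εA = ((List.finRange r).map fun j : Fin r =>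
          if s₂ ≤ (j : ℕ) then PuncturedSurfaceGroup.c (g := g) j else 1).prod *
        ((List.finRange g).map fun i : Fin g => if (i : ℕ) < g₀ then
          PuncturedSurfaceGroup.a (r := r) i * PuncturedSurfaceGroup.b i *
            (PuncturedSurfaceGroup.a i)⁻¹ * (PuncturedSurfaceGroup.b i)⁻¹ else 1).prod)
    (hη : η = ((List.finRange r).map fun j : Fin r =>
          if s₁ ≤ (j : ℕ) then PuncturedSurfaceGroup.c (g := g) j else 1).prod *
        ((List.finRange g).map fun i : Fin g => if (i : ℕ) < g₁ then
          PuncturedSurfaceGroup.a (r := r) i * PuncturedSurfaceGroup.b i *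
            (PuncturedSurfaceGroup.a i)⁻¹ * (PuncturedSurfaceGroup.b i)⁻¹ else 1).prod)
    (hV₀ : G.vertGp v₀ = ((Subgroup.closure {x : PuncturedSurfaceGroup g r |
        (∃ i : Fin g, (i : ℕ) < g₀ ∧ (x = PuncturedSurfaceGroup.a i ∨ x = PuncturedSurfaceGroup.b i)) ∨
        ∃ j : Fin r, s₂ ≤ (j : ℕ) ∧ x = PuncturedSurfaceGroup.c j}).map ι).topologicalClosure)
    (hVm : G.vertGp vm = ((Subgroup.closure {x : PuncturedSurfaceGroup g r |
        (∃ i : Fin g, (g₀ ≤ (i : ℕ) ∧ (i : ℕ) < g₁) ∧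
          (x = PuncturedSurfaceGroup.a i ∨ x = PuncturedSurfaceGroup.b i)) ∨
        (∃ j : Fin r, (s₁ ≤ (j : ℕ) ∧ (j : ℕ) < s₂) ∧ x = PuncturedSurfaceGroup.c j) ∨
        x = εA ∨ x = η}).map ι).topologicalClosure)
    (hV₁ : G.vertGp v₁ = ((Subgroup.closure {x : PuncturedSurfaceGroup g r |
        (∃ i : Fin g, g₁ ≤ (i : ℕ) ∧ (x = PuncturedSurfaceGroup.a i ∨ x = PuncturedSurfaceGroup.b i)) ∨
        (∃ j : Fin r, (j : ℕ) < s₁ ∧ x = PuncturedSurfaceGroup.c j) ∨ x = η}).map ι).topologicalClosure)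
    (nA nB : G.graph.N) (hN : ∀ n, n = nA ∨ n = nB)
    (hEA : G.nodeGp nA = ((Subgroup.zpowers εA).map ι).topologicalClosure)
    (hEB : G.nodeGp nB = ((Subgroup.zpowers η).map ι).topologicalClosure) :
    G.EdgeLikeSeparatingCoverings := by
  classical
  -- the two nodes are distinct (their groups are, by the free-factor package of gen 3)
  have hAB : nA ≠ nB := by
    obtain ⟨-, -, -, -, -, -, -, -, -, ⟨-, -, -, hne'⟩, -⟩ := G.threeChain_freeFactor_package hne hprime ι hι hg
      hs₁ hs₁₂ hs₂ e hC v₀ vm v₁ hV εA η hεA hη hV₀ hVm hV₁ nA nB hN hEA hEB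
    intro h
    apply hne'
    rw [h]
  obtain ⟨r', rfl⟩ : ∃ r', r = r' + 1 := ⟨r - 1, by omega⟩
  have hSig : ∃ ℓ ∈ Sigma, ℓ.Prime := hne.imp fun p hp => ⟨hp, hprime p hp⟩
  -- both node loops are members of the chain basis
  obtain ⟨B, -, -, -, -, -, -, hA, hBη, -, -, -⟩ := exists_chainBases hεA hη hg hs₁ (by omega) (by omega)
  -- generators of the edge groups
  let xs : G.graph.N ⊕ G.graph.C → PuncturedSurfaceGroup g (r' + 1) :=
    Sum.elim (fun n => if n = nA then εA else η) fun c' => c (e c')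
  have hxA : xs (Sum.inl nA) = εA := by
    show (if nA = nA then εA else η) = εA
    rw [if_pos rfl]
  have hxB : xs (Sum.inl nB) = η := by
    show (if nB = nA then εA else η) = η
    rw [if_neg (Ne.symm hAB)]
  have hxc : ∀ c', xs (Sum.inr c') = c (e c') := fun _ => rfl
  have hx : ∀ e', G.edgeGp e' = ((Subgroup.zpowers (xs e')).map ι).topologicalClosure := by
    rintro (n | c')
    · change G.nodeGp n = _
      rcases hN n with rfl | rfl
      · rw [hxA, hEA]
      · rw [hxB, hEB]
    · exact hC c'
  have hfac : ∀ e', ∃ (κ : Type) (bκ : FreeGroupBasis κ (PuncturedSurfaceGroup g (r' + 1))) (k : κ),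
      bκ k = xs e' := by
    rintro (n | c')
    · rcases hN n with rfl | rfl
      · exact ⟨_, B, Sum.inr ⟨s₂ - 1, by omega⟩, by rw [hxA]; exact hA (by omega)⟩
      · exact ⟨_, B, Sum.inr ⟨s₁ - 1, by omega⟩, by rw [hxB]; exact hBη (by omega)⟩
    · obtain ⟨β, bs, k, hk⟩ := exists_freeGroupBasis_eq_c (g := g) (by omega : 2 ≤ r' + 1) (e c')
      exact ⟨β, bs, k, hk⟩
  -- values of the twoDelta characters at non-special cusps and at `c_k`
  have hval0 : ∀ {k m j : Fin (r' + 1)}, j ≠ k → j ≠ m →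
      (ofAdd ((if j = k then (1 : ZMod 3) else 0) + (if j = m then (-1 : ZMod 3) else 0)) :
        Multiplicative (ZMod 3)) = 1 := by
    intro k m j hjk hjm
    rw [if_neg hjk, if_neg hjm, add_zero, ofAdd_zero]
  have hval1 : ∀ {k m : Fin (r' + 1)}, m ≠ k →
      (ofAdd ((if k = k then (1 : ZMod 3) else 0) + (if k = m then (-1 : ZMod 3) else 0)) :
        Multiplicative (ZMod 3)) ≠ 1 := by
    intro k m hmk
    rw [if_pos rfl, if_neg (Ne.symm hmk), add_zero]
    exact ofAdd_one_ne_one₃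
  -- the separating characters
  have hsep : ∀ e₁ e₂, e₁ ≠ e₂ → ∃ χ : PuncturedSurfaceGroup g (r' + 1) →* Multiplicative (ZMod 3),
      χ (xs e₂) = 1 ∧ χ (xs e₁) ≠ 1 := by
    rintro (n₁ | c₁) (n₂ | c₂) hne12
    · -- node / node
      rcases hN n₁ with rfl | rfl <;> rcases hN n₂ with rfl | rfl
      · exact absurd rfl hne12
      · -- alive `ν_A`, killed `ν_B`: `δ_{s₂} − δ_{s₁}`
        obtain ⟨χ, -, hχA, hχB⟩ :=
          exists_twoDelta_character₂ g₀ g₁ s₁ s₂ ⟨s₂, by omega⟩ ⟨s₁, by omega⟩ εA η hεA hη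
        refine ⟨χ, ?_, ?_⟩
        · rw [hxB, hχB, if_pos (show s₁ ≤ ((⟨s₂, _⟩ : Fin (r' + 1)) : ℕ) by simp only; omega),
            if_pos (show s₁ ≤ ((⟨s₁, _⟩ : Fin (r' + 1)) : ℕ) by simp only; omega), add_neg_cancel, ofAdd_zero]
        · rw [hxA, hχA, if_pos (show s₂ ≤ ((⟨s₂, _⟩ : Fin (r' + 1)) : ℕ) by simp only; omega),
            if_neg (show ¬ s₂ ≤ ((⟨s₁, _⟩ : Fin (r' + 1)) : ℕ) by simp only; omega), add_zero]
          exact ofAdd_one_ne_one₃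
      · -- alive `ν_B`, killed `ν_A`: `δ_{s₁} − δ_0`
        obtain ⟨χ, -, hχA, hχB⟩ :=
          exists_twoDelta_character₂ g₀ g₁ s₁ s₂ ⟨s₁, by omega⟩ ⟨0, by omega⟩ εA η hεA hη
        refine ⟨χ, ?_, ?_⟩
        · rw [hxA, hχA, if_neg (show ¬ s₂ ≤ ((⟨s₁, _⟩ : Fin (r' + 1)) : ℕ) by simp only; omega),
            if_neg (show ¬ s₂ ≤ ((⟨0, _⟩ : Fin (r' + 1)) : ℕ) by simp only; omega), add_zero, ofAdd_zero]
        · rw [hxB, hχB, if_pos (show s₁ ≤ ((⟨s₁, _⟩ : Fin (r' + 1)) : ℕ) by simp only; omega),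
            if_neg (show ¬ s₁ ≤ ((⟨0, _⟩ : Fin (r' + 1)) : ℕ) by simp only; omega), add_zero]
          exact ofAdd_one_ne_one₃
      · exact absurd rfl hne12
    · -- alive node, killed cusp `c_{k₂}`
      set k₂ := e c₂ with hk₂
      obtain ⟨m, hm1, hmk₂⟩ : ∃ m : Fin (r' + 1), (m : ℕ) ≤ 1 ∧ m ≠ k₂ := by
        obtain ⟨m, -, hm1, hmk⟩ := exists_window_ne (r := r' + 1) 0 (by omega) k₂
        exact ⟨m, by omega, hmk⟩
      rcases hN n₁ with rfl | rfl
      · obtain ⟨k, hk1, hk2, hkk₂⟩ := exists_window_ne (r := r' + 1) s₂ (by omega) k₂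
        obtain ⟨χ, hχc, hχA, -⟩ := exists_twoDelta_character₂ g₀ g₁ s₁ s₂ k m εA η hεA hη
        refine ⟨χ, ?_, ?_⟩
        · rw [hxc, hχc, hval0 (Ne.symm hkk₂) (Ne.symm hmk₂)]
        · rw [hxA, hχA, if_pos hk1, if_neg (show ¬ s₂ ≤ (m : ℕ) by omega), add_zero]
          exact ofAdd_one_ne_one₃
      · obtain ⟨k, hk1, hk2, hkk₂⟩ := exists_window_ne (r := r' + 1) s₁ (by omega) k₂
        obtain ⟨χ, hχc, -, hχB⟩ := exists_twoDelta_character₂ g₀ g₁ s₁ s₂ k m εA η hεA hη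
        refine ⟨χ, ?_, ?_⟩
        · rw [hxc, hχc, hval0 (Ne.symm hkk₂) (Ne.symm hmk₂)]
        · rw [hxB, hχB, if_pos hk1, if_neg (show ¬ s₁ ≤ (m : ℕ) by omega), add_zero]
          exact ofAdd_one_ne_one₃
    · -- alive cusp `c_{k₁}`, killed node: `δ_{k₁} − δ_m` with `m` on the same side of the threshold
      set k₁ := e c₁ with hk₁
      have key : ∀ t : ℕ, 2 ≤ t → t + 2 ≤ r' + 1 →
          ∃ m : Fin (r' + 1), m ≠ k₁ ∧ ((t ≤ (k₁ : ℕ)) ↔ (t ≤ (m : ℕ))) := by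
        intro t ht2 htr
        by_cases hk : t ≤ (k₁ : ℕ)
        · obtain ⟨m, hm1, -, hmk⟩ := exists_window_ne (r := r' + 1) t htr k₁
          exact ⟨m, hmk, ⟨fun _ => hm1, fun _ => hk⟩⟩
        · obtain ⟨m, -, hm1, hmk⟩ := exists_window_ne (r := r' + 1) 0 (by omega) k₁
          exact ⟨m, hmk, ⟨fun h => absurd h hk, fun h => by omega⟩⟩
      have hvan : ∀ (t : ℕ) (m : Fin (r' + 1)), ((t ≤ (k₁ : ℕ)) ↔ (t ≤ (m : ℕ))) →
          (ofAdd ((if t ≤ (k₁ : ℕ) then (1 : ZMod 3) else 0) + (if t ≤ (m : ℕ) then (-1 : ZMod 3) else 0)) :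
            Multiplicative (ZMod 3)) = 1 := by
        intro t m hiff
        by_cases h : t ≤ (k₁ : ℕ)
        · rw [if_pos h, if_pos (hiff.mp h), add_neg_cancel, ofAdd_zero]
        · rw [if_neg h, if_neg (fun h' => h (hiff.mpr h')), add_zero, ofAdd_zero]
      rcases hN n₂ with rfl | rfl
      · obtain ⟨m, hmk₁, hiff⟩ := key s₂ (by omega) (by omega)
        obtain ⟨χ, hχc, hχA, -⟩ := exists_twoDelta_character₂ g₀ g₁ s₁ s₂ k₁ m εA η hεA hη
        refine ⟨χ, ?_, ?_⟩
        · rw [hxA, hχA, hvan s₂ m hiff]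
        · rw [hxc, hχc]; exact hval1 hmk₁
      · obtain ⟨m, hmk₁, hiff⟩ := key s₁ hs₁ (by omega)
        obtain ⟨χ, hχc, -, hχB⟩ := exists_twoDelta_character₂ g₀ g₁ s₁ s₂ k₁ m εA η hεA hη
        refine ⟨χ, ?_, ?_⟩
        · rw [hxB, hχB, hvan s₁ m hiff]
        · rw [hxc, hχc]; exact hval1 hmk₁
    · -- cusp / cusp
      set k₁ := e c₁ with hk₁
      set k₂ := e c₂ with hk₂
      have hk12 : k₁ ≠ k₂ := fun h => hne12 (by rw [e.injective h])
      obtain ⟨m, hmk₁, hmk₂⟩ := exists_ne_ne₃ (by omega : 3 ≤ r' + 1) k₁ k₂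
      obtain ⟨χ, hχc, -, -⟩ := exists_twoDelta_character₂ g₀ g₁ s₁ s₂ k₁ m εA η hεA hη
      refine ⟨χ, ?_, ?_⟩
      · rw [hxc, hχc, hval0 (Ne.symm hk12) (Ne.symm hmk₂)]
      · rw [hxc, hχc]; exact hval1 hmk₁
  exact G.edgeLikeSeparatingCoverings_of_rankOneFreeFactors hι hSig xs hx hfac hsep

end ThreeChain

end PSCDatum

end Literature.AnabelianGeometry.SemiGraphs

end
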